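import Literature.NumberTheory.Automorphic.Liu2021.AppendixC.OmegaHomBlockCarrier
import Literature.NumberTheory.Automorphic.Liu2021.AppendixC.OmegaHomBlockFieldCharacterLevelwise
import Literature.RingTheory.SimpleModule.BlockFieldCharacter
import Literature.RingTheory.SimpleModule.SemisimpleBaseChange
import HarnessLib

/-!
# [Liu 2021, App. D §D.4 / Prop. D.4 (1)] the `ε`-block of the Hecke image, II: central characters of the block field on `W_ε`,
# and MULTIPLICITY ONE at the block of `ω⋆` (piece 2 of the (MO) producer)

Topic `NumberTheory/Automorphic/Liu2021/AppendixC`; namespace `Literature.NumberTheory.Automorphic.Liu2021.AppendixC.Sec42Data.HeckeTranslates`.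
Theorems only — no definition, no named fact, no instance, no `sorry`.  Continues ★ `OmegaHomBlockCarrier` (same abstract carrier
`(W_ε, iW, act′)` pinned by `hW : range iW = range (ᵗV_ℓ^ℚ ε ⊗ 1)` and `hact : iW (act′ h w) = (ᵗV_ℓ^ℚ h ⊗ 1) (iW w)`; `A := ℚ̄_ℓ⟨range act′⟩`).

* §1 `act'_mul` / `act'_add` / `act'_block_eq_one` — `act′` is additive, ANTI-multiplicative, and `act′ ε = 1` (bookkeeping from `hact`).
* §2 `exists_character_blockCarrier` — for a block field `φ : R₀ → Z(H)·ε` (`φ` multiplicative, `φ 1 = ε`, central values in `H`) every simple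
  `A`-submodule `N ≤ W_ε` has a CHARACTER `τ_N : R₀ →+* ℚ̄_ℓ` through which the `act′ (φ r)` act on `N` (Schur, ★ `BlockFieldCharacter`), and they act
  through `τ_N` on the whole isotypic component of `N` (★ `CentralCharacterIsotypic`).
* §3 `mem_omegaBlock_of_forall_eigen` — MULTIPLICITY ONE AT THE BASE BLOCK (σ-free: semisimplicity through `hHK`, `hssM`): if `τ₀` is the character of the `ω⋆`-sub-block `N₀′` (★
  `exists_simple_omegaBlock`) and every element of `Hom_G(ι∘ω, ℚ̄_ℓ ⊗ H¹_ét(A_∞))` is a multiple of `f′` (`hm1` = [Liu2021, Prop. D.4 (1)]), then every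
  `τ₀`-eigenvector of the `act′ (φ r)` in `W_ε` lies in `N₀′` — the `ℚ̄_ℓ ⊗ H¹_ét(A_K)`-level dictionary «isotypic component = eigenspace of the block
  field» (★ `mem_isotypicComponent_of_forall_smul_eq_smul`, `hZ` by ★ `mem_span_of_forall_comm_of_mul_eq_of_isSemisimpleRing`) combined with the
  LEVELWISE ★ `map_isotypicComponent_le_span_blockValues_of_levelwise` (the argument of ★ `isotypicComponent_eq_of_forall_eq_smul`).

HC_CM is proved only modulo the 7 printed citations until rung 0 closes; this file moves no book.
Co-produced with A-p05 (g12) (cell hodgecm-mathlib; his monolith `OmegaHomBlockMultOne.reportfirst.A-p05g12.lean` is the twin road).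


## References
* [Liu2021] Y. Liu, *Fourier–Jacobi cycles and arithmetic relative trace formula*, Camb. J. Math. 9 (2021): p. 133 (D.3), Prop. D.4 (1) p. 130,
  App. D §D.4 pp. 139–140 (FJcycle.tex l. 5626–5631).
* [Lam2001FirstCourse] T. Y. Lam, *A First Course in Noncommutative Rings* (2001), §3 Thm. (3.5), Lemma (3.8), §22 Prop. (22.1)–(22.2).
* [BourbakiAlgebreVIII2012] N. Bourbaki, *Algèbre, Ch. VIII* (2012), §3 no. 2 (lemme de Schur), §5 no. 1.
-/

set_option autoImplicit false

noncomputable section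

open CategoryTheory NumberField Function Cardinal
open scoped TensorProduct Cardinal

namespace Literature.NumberTheory.Automorphic.Liu2021.AppendixC

open Literature.AlgebraicGeometry.Motives (AbelianVariety)
open Literature.AlgebraicGeometry.Motives.AbelianVariety (rationalTateModuleMap endAlgebra rationalTateAction)

variable {F E : Type} [Field F] [NumberField F] [IsTotallyReal F] [Field E] [NumberField E] [Algebra F E]
  [IsTotallyComplex E] [Algebra.IsQuadraticExtension F E]
variable {P5 : PropC5Data F E} {isotropicAt : ℕ → Prop}

namespace Sec42Data.HeckeTranslates

variable {C : Sec42Data P5 isotropicAt} (T : C.HeckeTranslates) {ℓ : ℕ} [Fact ℓ.Prime]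
variable (K : C5.SmallLevel C.S.K₀)
  (hI : ∀ ⦃K K' : C5.SmallLevel C.S.K₀⦄ (f : K' ⟶ K), Function.Injective (rationalTateModuleMap ℓ (C.Atr f)).dualMap)
  (X : C.EtaleHeckeDatum ℓ) (hX : X.rhoEt = T.etHeckeRep ℓ) (ι : ℂ ≃+* AlgebraicClosure ℚ_[ℓ])
  {W : Type} [AddCommGroup W] [Module ℂ W] (ρW : Representation ℂ C.G W)
  {f : W →ₛₗ[(ι : ℂ →+* AlgebraicClosure ℚ_[ℓ])] AlgebraicClosure ℚ_[ℓ] ⊗[ℚ_[ℓ]] C.etaleH1Tower ℓ} (hf : f ∈ X.omegaHom ι ρW)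
  (σ : Representation (AlgebraicClosure ℚ_[ℓ]) C.G (AlgebraicClosure ℚ_[ℓ] ⊗[ℚ_[ℓ]] C.etaleH1Tower ℓ))
  (hσ : ∀ g : C.G, σ g = (X.rhoEt g).baseChange (AlgebraicClosure ℚ_[ℓ]))

section Characters

variable {Wε : Type} [AddCommGroup Wε] [Module (AlgebraicClosure ℚ_[ℓ]) Wε]
  (iW : Wε →ₗ[AlgebraicClosure ℚ_[ℓ]] AlgebraicClosure ℚ_[ℓ] ⊗[ℚ_[ℓ]] C.etaleH1 ℓ K) (hiW : Function.Injective iW)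

/-! ## §1 Bookkeeping: `act′` is additive, anti-multiplicative, and `act′ ε = 1` on the block carrier -/

section ActLaws

variable {hD : T.IsogenyDescent} (act' : ↥(T.heckeImage hD K) → Module.End (AlgebraicClosure ℚ_[ℓ]) Wε)
  (hact : ∀ (h : ↥(T.heckeImage hD K)) (w : Wε),
    iW (act' h w) = ((rationalTateAction (C.A K) ℓ (h : (C.A K).endAlgebra)).dualMap).baseChange (AlgebraicClosure ℚ_[ℓ]) (iW w))

include hiW hact in
/-- `act′ (x y) = act′ y ∘ act′ x` (the realisation `x ↦ ᵗV_ℓ^ℚ x ⊗ 1` is anti-multiplicative). [cite: MumfordAV1970, §19 Thm. 3] -/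
theorem act'_mul (x y : ↥(T.heckeImage hD K)) : act' (x * y) = act' y * act' x := by
  ext w
  apply hiW
  rw [hact, Module.End.mul_apply, hact, hact, Subalgebra.coe_mul]
  exact congrArg (fun u => u (iW w)) (baseChange_dualMap_rationalTateAction_mul ℓ K (x : (C.A K).endAlgebra) y)

include hiW hact in
/-- `act′ (x + y) = act′ x + act′ y`. [cite: MumfordAV1970, §19 Thm. 3] -/
theorem act'_add (x y : ↥(T.heckeImage hD K)) : act' (x + y) = act' x + act' y := by
  ext w
  apply hiW
  rw [hact, LinearMap.add_apply, map_add, hact, hact, Subalgebra.coe_add]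
  exact congrArg (fun u => u (iW w)) (baseChange_dualMap_rationalTateAction_add ℓ K (x : (C.A K).endAlgebra) y)

include hiW hact in
/-- `act′ ε = 1` on the block carrier (`range iW = range (ᵗV_ℓ^ℚ ε ⊗ 1)` and `ε² = ε`). [cite: Lam2001FirstCourse, §22 Prop. (22.1) (p. 327)] -/
theorem act'_block_eq_one {ε : (C.A K).endAlgebra} (hε : IsIdempotentElem ε) (hεH : ε ∈ T.heckeImage hD K)
    (hW : LinearMap.range iW = LinearMap.range (((rationalTateAction (C.A K) ℓ ε).dualMap).baseChange (AlgebraicClosure ℚ_[ℓ]))) :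
    act' ⟨ε, hεH⟩ = 1 := by
  ext w
  apply hiW
  rw [hact, Module.End.one_apply]
  exact (mem_range_baseChange_dualMap_iff K hε (iW w)).1 (hW ▸ LinearMap.mem_range_self iW w)

include hiW hact in
/-- Every `act′ (φ r)` with `φ r` central in `H` is CENTRAL in `A = ℚ̄_ℓ⟨range act′⟩`. [cite: Lam2001FirstCourse, §22 Prop. (22.1) (p. 327)] -/
theorem act'_comm_of_forall_comm {z : ↥(T.heckeImage hD K)} (hz : ∀ h ∈ T.heckeImage hD K, (z : (C.A K).endAlgebra) * h = h * z)
    (x : Module.End (AlgebraicClosure ℚ_[ℓ]) Wε) (hx : x ∈ Algebra.adjoin (AlgebraicClosure ℚ_[ℓ]) (Set.range act')) :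
    act' z * x = x * act' z := by
  induction hx using Algebra.adjoin_induction with
  | mem s hs =>
    obtain ⟨h, rfl⟩ := hs
    rw [← T.act'_mul K iW hiW act' hact, ← T.act'_mul K iW hiW act' hact]
    congr 1
    exact Subtype.ext ((hz h h.2).symm)
  | algebraMap c => exact (Algebra.commutes c _).symm
  | add a b _ _ ha hb => rw [mul_add, add_mul, ha, hb]
  | mul a b _ _ ha hb => rw [← mul_assoc, ha, mul_assoc, hb, mul_assoc]

end ActLaws

/-! ## §2 Characters of the block field on simple `A`-submodules of `W_ε`, and on their isotypic components -/

section Characters2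

variable {hD : T.IsogenyDescent} (act' : ↥(T.heckeImage hD K) → Module.End (AlgebraicClosure ℚ_[ℓ]) Wε)
  (hact : ∀ (h : ↥(T.heckeImage hD K)) (w : Wε),
    iW (act' h w) = ((rationalTateAction (C.A K) ℓ (h : (C.A K).endAlgebra)).dualMap).baseChange (AlgebraicClosure ℚ_[ℓ]) (iW w))

include hiW hact in
/-- **The character of a simple `A`-submodule along the block field, and on its isotypic component** ([Liu2021] p. 140: «`M_λ` acts on the
`π`-isotypic part through `λ`»).  For `φ : R₀ → H` multiplicative with `φ 1 = ε` and central values (a block field `R₀ ≅ Z(H)·ε`) and a simple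
`A`-submodule `N ≤ W_ε`, `A = ℚ̄_ℓ⟨range act′⟩`: there is a ring homomorphism `τ : R₀ →+* ℚ̄_ℓ` with `act′ (φ r) = τ r` on `N` (Schur, ★
`BlockFieldCharacter.exists_ringHom_forall_smul_eq`; `act′ ∘ φ` is anti-multiplicative with central values and `act′ (φ 1) = act′ ε = 1`), and
`act′ (φ r) = τ r` on the whole `N`-isotypic component (★ `smul_eq_smul_of_mem_isotypicComponent_of_algebraMap`).
[cite: Liu2021, App. D §D.4 p. 140 (FJcycle.tex l. 5626–5631)] [cite: BourbakiAlgebreVIII2012, §3 no. 2 (lemme de Schur)]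
[cite: Lam2001FirstCourse, §3 Thm. (3.5) (pp. 33–35) and §22 Prop. (22.1) (p. 327)] -/
theorem exists_character_blockCarrier [FiniteDimensional (AlgebraicClosure ℚ_[ℓ]) Wε]
    {ε : (C.A K).endAlgebra} (hε : IsIdempotentElem ε) (hεH : ε ∈ T.heckeImage hD K)
    (hW : LinearMap.range iW = LinearMap.range (((rationalTateAction (C.A K) ℓ ε).dualMap).baseChange (AlgebraicClosure ℚ_[ℓ])))
    {R₀ : Type} [Field R₀] [NumberField R₀] (φ : R₀ →ₗ[ℚ] (C.A K).endAlgebra) (hφmul : ∀ a b, φ (a * b) = φ a * φ b)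
    (hφ1 : φ 1 = ε) (hφH : ∀ r, φ r ∈ T.heckeImage hD K) (hφc : ∀ r, ∀ h ∈ T.heckeImage hD K, φ r * h = h * φ r)
    (N : Submodule ↥(Algebra.adjoin (AlgebraicClosure ℚ_[ℓ]) (Set.range act')) Wε)
    [IsSimpleModule ↥(Algebra.adjoin (AlgebraicClosure ℚ_[ℓ]) (Set.range act')) ↥N] :
    ∃ τ : R₀ →+* AlgebraicClosure ℚ_[ℓ], (∀ r : R₀, ∀ n ∈ N, act' ⟨φ r, hφH r⟩ n = τ r • n) ∧
      ∀ m ∈ isotypicComponent ↥(Algebra.adjoin (AlgebraicClosure ℚ_[ℓ]) (Set.range act')) Wε ↥N,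
        ∀ r : R₀, act' ⟨φ r, hφH r⟩ m = τ r • m := by
  classical
  have hmemA : ∀ r, act' ⟨φ r, hφH r⟩ ∈ Algebra.adjoin (AlgebraicClosure ℚ_[ℓ]) (Set.range act') :=
    fun r => Algebra.subset_adjoin ⟨_, rfl⟩
  have h0 : act' 0 = 0 := by
    have h := T.act'_add K iW hiW act' hact 0 0
    rw [add_zero] at h
    exact left_eq_add.1 h
  -- `φ` read in `H`
  have hφ0 : (⟨φ 0, hφH 0⟩ : ↥(T.heckeImage hD K)) = 0 :=
    Subtype.ext (by change φ 0 = 0; rw [map_zero])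
  have hφadd : ∀ r s, (⟨φ (r + s), hφH (r + s)⟩ : ↥(T.heckeImage hD K)) = ⟨φ r, hφH r⟩ + ⟨φ s, hφH s⟩ :=
    fun r s => Subtype.ext (by change φ (r + s) = φ r + φ s; rw [map_add])
  have hφmul' : ∀ r s, (⟨φ (r * s), hφH (r * s)⟩ : ↥(T.heckeImage hD K)) = ⟨φ r, hφH r⟩ * ⟨φ s, hφH s⟩ :=
    fun r s => Subtype.ext (hφmul r s)
  have hφone : (⟨φ 1, hφH 1⟩ : ↥(T.heckeImage hD K)) = ⟨ε, hεH⟩ := Subtype.ext hφ1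
  -- the block-field map `a = act′ ∘ φ : R₀ →+ A`
  let a : R₀ →+ ↥(Algebra.adjoin (AlgebraicClosure ℚ_[ℓ]) (Set.range act')) :=
    { toFun := fun r => ⟨act' ⟨φ r, hφH r⟩, hmemA r⟩
      map_zero' := Subtype.ext (by change act' ⟨φ 0, hφH 0⟩ = 0; rw [hφ0, h0])
      map_add' := fun r s => Subtype.ext (by
        change act' ⟨φ (r + s), hφH (r + s)⟩ = act' ⟨φ r, hφH r⟩ + act' ⟨φ s, hφH s⟩
        rw [hφadd, T.act'_add K iW hiW act' hact]) }
  have ha : ∀ r, ((a r : ↥(Algebra.adjoin (AlgebraicClosure ℚ_[ℓ]) (Set.range act'))) : Module.End (AlgebraicClosure ℚ_[ℓ]) Wε) =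
      act' ⟨φ r, hφH r⟩ := fun _ => rfl
  have hmul : ∀ r s, a (r * s) = a s * a r := fun r s => Subtype.ext (by
    rw [Subalgebra.coe_mul, ha, ha, ha, hφmul', T.act'_mul K iW hiW act' hact])
  have hcen : ∀ (r : R₀) (x : ↥(Algebra.adjoin (AlgebraicClosure ℚ_[ℓ]) (Set.range act'))), x * a r = a r * x := fun r x =>
    Subtype.ext (by
      rw [Subalgebra.coe_mul, Subalgebra.coe_mul, ha]
      exact (T.act'_comm_of_forall_comm K iW hiW act' hact (hφc r) x.1 x.2).symm)
  have hone : ∀ n ∈ N, a 1 • n = n := by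
    intro n _
    change act' ⟨φ 1, hφH 1⟩ n = n
    rw [hφone, T.act'_block_eq_one K iW hiW act' hact hε hεH hW, Module.End.one_apply]
  obtain ⟨τ, hτ⟩ := Literature.RingTheory.SimpleModule.exists_ringHom_forall_smul_eq (L := AlgebraicClosure ℚ_[ℓ]) N a hmul hcen hone
  refine ⟨τ, fun r n hn => hτ r n hn, fun m hm r => ?_⟩
  exact Literature.RingTheory.SimpleModule.smul_eq_smul_of_mem_isotypicComponent_of_algebraMap (z := a r)
    (fun x => (hcen r x).symm) (τ r) N (hτ r) hm

end Characters2

/-! ## §3 Multiplicity one at the block of `ω⋆`: `τ₀`-eigenvectors of the block field lie in `N₀′` -/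

section MultOne

variable {hD : T.IsogenyDescent} (act' : ↥(T.heckeImage hD K) → Module.End (AlgebraicClosure ℚ_[ℓ]) Wε)
  (hact : ∀ (h : ↥(T.heckeImage hD K)) (w : Wε),
    iW (act' h w) = ((rationalTateAction (C.A K) ℓ (h : (C.A K).endAlgebra)).dualMap).baseChange (AlgebraicClosure ℚ_[ℓ]) (iW w))

set_option maxHeartbeats 400000 in
include hI hX hf hσ hiW hact in
/-- **MULTIPLICITY ONE AT THE BASE BLOCK** (σ-free: semisimplicity enters through `hHK`, `hssM`) ([Liu2021] Prop. D.4 (1) «`dim Hom_G(ω, H¹) = 1`», read on the `ε`-block).  Let `φ : R₀ → Z(H)·ε` be a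
block field (every central `z ∈ H` has `z ε ∈ φ(R₀)`), `N₀′ ≤ W_ε` the `ω⋆`-sub-block (`w ∈ N₀′ ↔ [iW w]_K ∈ f′(ω^K)`), non-zero, on which the
`act′ (φ r)` act through `τ₀ : R₀ →+* ℚ̄_ℓ`, and suppose every element of `Hom_G(ι∘ω, ℚ̄_ℓ ⊗ H¹_ét(A_∞))` is a multiple of `f′` (`hm1`).  Then EVERY
`w ∈ W_ε` with `act′ (φ r) w = τ₀ r • w` for all `r` lies in `N₀′`.  Proof in `M = ℚ̄_ℓ ⊗ H¹_ét(A_K)`: the `τ₀`-eigenvectors of the `ᵗV_ℓ^ℚ(φ r) ⊗ 1` are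
`N_M`-isotypic over `𝒜 = ℚ̄_ℓ⟨Hecke⟩` (★ `mem_isotypicComponent_of_forall_smul_eq_smul`, the `hZ` input from ★ `mem_span_of_forall_comm_of_mul_eq`),
and the `N_M`-isotypic component is `N_M` itself (★ `isotypicComponent_eq_of_forall_eq_smul`).
[cite: Liu2021, p. 133 (D.3) and Prop. D.4 (1) (p. 130)] [cite: Lam2001FirstCourse, §3 Thm. (3.5) (pp. 33–35) and §22 Prop. (22.1) (p. 327)] -/
theorem mem_omegaBlock_of_forall_eigen [ρW.IsIrreducible]
    (hHK : IsSemisimpleRing ↥(T.heckeImage hD K))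
    (hssM : ∀ K' : C5.SmallLevel C.S.K₀,
      IsSemisimpleModule ↥(Algebra.adjoin (AlgebraicClosure ℚ_[ℓ])
        ((Set.range fun g : C.G => ((rationalTateAction (C.A K') ℓ (T.heckeEnd hD K' g)).dualMap).baseChange (AlgebraicClosure ℚ_[ℓ])) :
          Set (Module.End (AlgebraicClosure ℚ_[ℓ]) (AlgebraicClosure ℚ_[ℓ] ⊗[ℚ_[ℓ]] C.etaleH1 ℓ K'))))
        (AlgebraicClosure ℚ_[ℓ] ⊗[ℚ_[ℓ]] C.etaleH1 ℓ K'))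
    (hf0 : ∃ w ∈ ρW.fixedPoints (K.1.1 : Subgroup C.G), f w ≠ 0)
    {ε : (C.A K).endAlgebra} (hεH : ε ∈ T.heckeImage hD K)
    (hsel : ∀ w ∈ ρW.fixedPoints (K.1.1 : Subgroup C.G), ∀ x : (AlgebraicClosure ℚ_[ℓ]) ⊗[ℚ_[ℓ]] C.etaleH1 ℓ K,
        (C.toTower ℓ K).baseChange (AlgebraicClosure ℚ_[ℓ]) x = f w →
          (C.toTower ℓ K).baseChange (AlgebraicClosure ℚ_[ℓ])
            (((rationalTateAction (C.A K) ℓ ε).dualMap).baseChange (AlgebraicClosure ℚ_[ℓ]) x) = f w)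
    {R₀ : Type} [Field R₀] [NumberField R₀] (φ : R₀ →ₗ[ℚ] (C.A K).endAlgebra) (hφmul : ∀ a b, φ (a * b) = φ a * φ b)
    (hφ1 : φ 1 = ε) (hφH : ∀ r, φ r ∈ T.heckeImage hD K) (hφc : ∀ r, ∀ h ∈ T.heckeImage hD K, φ r * h = h * φ r)
    (hφsurj : ∀ z ∈ T.heckeImage hD K, (∀ y ∈ T.heckeImage hD K, z * y = y * z) → ∃ r : R₀, φ r = z * ε)
    (hm1 : ∀ f₁ ∈ X.omegaHom ι ρW, ∃ c : AlgebraicClosure ℚ_[ℓ], f₁ = c • f)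
    (N₀ : Submodule ↥(Algebra.adjoin (AlgebraicClosure ℚ_[ℓ]) (Set.range act')) Wε) (hN0 : N₀ ≠ ⊥)
    (hN₀ : ∀ w : Wε, w ∈ N₀ ↔
      (C.toTower ℓ K).baseChange (AlgebraicClosure ℚ_[ℓ]) (iW w) ∈ (ρW.fixedPoints (K.1.1 : Subgroup C.G)).map f)
    (τ₀ : R₀ →+* AlgebraicClosure ℚ_[ℓ]) (hτ₀ : ∀ r : R₀, ∀ n ∈ N₀, act' ⟨φ r, hφH r⟩ n = τ₀ r • n)
    {w : Wε} (hw : ∀ r : R₀, act' ⟨φ r, hφH r⟩ w = τ₀ r • w) : w ∈ N₀ := by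
  classical
  -- OPAQUE abbreviations: `j = [·]_K ⊗ 1`, `op x = ᵗV_ℓ^ℚ x ⊗ 1`, `S = {op (heckeEnd K g)}`
  obtain ⟨j, hj⟩ : ∃ j : (AlgebraicClosure ℚ_[ℓ] ⊗[ℚ_[ℓ]] C.etaleH1 ℓ K) →ₗ[AlgebraicClosure ℚ_[ℓ]]
      AlgebraicClosure ℚ_[ℓ] ⊗[ℚ_[ℓ]] C.etaleH1Tower ℓ, j = (C.toTower ℓ K).baseChange (AlgebraicClosure ℚ_[ℓ]) := ⟨_, rfl⟩
  have hjinj : Function.Injective j := by rw [hj]; exact toTower_baseChange_injective C ℓ (C.toTower_injective ℓ hI K)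
  obtain ⟨op, hop⟩ : ∃ op : (C.A K).endAlgebra →
      Module.End (AlgebraicClosure ℚ_[ℓ]) (AlgebraicClosure ℚ_[ℓ] ⊗[ℚ_[ℓ]] C.etaleH1 ℓ K),
      op = fun x => ((rationalTateAction (C.A K) ℓ x).dualMap).baseChange (AlgebraicClosure ℚ_[ℓ]) := ⟨_, rfl⟩
  have hop' : ∀ x, op x = ((rationalTateAction (C.A K) ℓ x).dualMap).baseChange (AlgebraicClosure ℚ_[ℓ]) := fun x => by rw [hop]
  have op_mul : ∀ x y, op (x * y) = op y * op x := fun x y => by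
    rw [hop', hop', hop', Module.End.mul_eq_comp]; exact baseChange_dualMap_rationalTateAction_mul ℓ K x y
  have op_add : ∀ x y, op (x + y) = op x + op y := fun x y => by
    rw [hop', hop', hop']; exact baseChange_dualMap_rationalTateAction_add ℓ K x y
  have op_zero : op 0 = 0 := by rw [hop', baseChange_dualMap_rationalTateAction_zero ℓ K]
  obtain ⟨S, hS⟩ : ∃ S : Set (Module.End (AlgebraicClosure ℚ_[ℓ]) (AlgebraicClosure ℚ_[ℓ] ⊗[ℚ_[ℓ]] C.etaleH1 ℓ K)),
      S = Set.range fun g : C.G => ((rationalTateAction (C.A K) ℓ (T.heckeEnd hD K g)).dualMap).baseChange (AlgebraicClosure ℚ_[ℓ]) :=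
    ⟨_, rfl⟩
  have hSop : S = Set.range fun g : C.G => op (T.heckeEnd hD K g) := by rw [hS, hop]
  have h𝒜gen : ∀ g : C.G, ((rationalTateAction (C.A K) ℓ (T.heckeEnd hD K g)).dualMap).baseChange (AlgebraicClosure ℚ_[ℓ]) ∈
      Algebra.adjoin (AlgebraicClosure ℚ_[ℓ]) S := fun g => Algebra.subset_adjoin (by rw [hS]; exact ⟨g, rfl⟩)
  have hop𝒜 : ∀ x ∈ T.heckeImage hD K, op x ∈ Algebra.adjoin (AlgebraicClosure ℚ_[ℓ]) S := fun x hx => by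
    rw [hop', hS]; exact T.baseChange_dualMap_rationalTateAction_mem_adjoin ℓ K hD hx
  haveI := module_finite_baseChange_etaleH1 (C := C) ℓ K
  -- `𝒜` is a semisimple ring: a quotient of the semisimple `ℚ̄_ℓ ⊗_ℚ Hᵐᵒᵖ` (★ `exists_algHom_tensor_mulOpposite_heckeImage_surjective`)
  haveI : IsSemisimpleRing ↥(Algebra.adjoin (AlgebraicClosure ℚ_[ℓ]) S) := by
    obtain ⟨Φ, hΦs, -⟩ := T.exists_algHom_tensor_mulOpposite_heckeImage_surjective K hD S hS
    haveI : IsSemisimpleRing ↥(T.heckeImage hD K) := hHK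
    haveI : Module.Finite ℚ ↥(T.heckeImage hD K) := T.module_finite_heckeImage hD K
    haveI : IsSemisimpleRing (AlgebraicClosure ℚ_[ℓ] ⊗[ℚ] (↥(T.heckeImage hD K))ᵐᵒᵖ) :=
      Literature.RingTheory.SimpleModule.isSemisimpleRing_baseChange ℚ (↥(T.heckeImage hD K))ᵐᵒᵖ (AlgebraicClosure ℚ_[ℓ])
    exact RingHom.isSemisimpleRing_of_surjective Φ.toRingHom hΦs
  -- the `M`-level block module `N_M = j⁻¹ f′(ω^K)`, simple over `𝒜`
  obtain ⟨NM, hNM⟩ := T.exists_submodule_adjoin_restrictScalars_eq K X hX ι ρW hf hD S hS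
  have hNM0 : NM ≠ ⊥ := T.ne_bot_of_restrictScalars_eq K hI X hX ι ρW hf hD hf0 NM hNM
  have hcoe : (NM : Set (AlgebraicClosure ℚ_[ℓ] ⊗[ℚ_[ℓ]] C.etaleH1 ℓ K)) =
      ((ρW.fixedPoints (K.1.1 : Subgroup C.G)).map f).comap ((C.toTower ℓ K).baseChange (AlgebraicClosure ℚ_[ℓ])) := by
    rw [← Submodule.coe_restrictScalars (AlgebraicClosure ℚ_[ℓ]) NM, hNM]
  haveI hsimple := Literature.RingTheory.SimpleModule.isSimpleModule_of_forall_stable S NM hNM0 fun U hU hUS => by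
    rw [hcoe] at hU ⊢
    rw [hS] at hUS
    exact T.eq_bot_or_coe_eq_of_forall_heckeEnd_stable K hI X hX ι ρW hf hD U hU hUS
  have hmemNM : ∀ x, x ∈ NM ↔ j x ∈ (ρW.fixedPoints (K.1.1 : Subgroup C.G)).map f := fun x => by
    rw [← Submodule.restrictScalars_mem (AlgebraicClosure ℚ_[ℓ]), hNM, Submodule.mem_comap, hj]
  -- the block-field map `a₀ = op ∘ φ : R₀ →+ 𝒜`
  let a₀ : R₀ →+ ↥(Algebra.adjoin (AlgebraicClosure ℚ_[ℓ]) S) :=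
    { toFun := fun r => ⟨op (φ r), hop𝒜 _ (hφH r)⟩
      map_zero' := Subtype.ext (by change op (φ 0) = 0; rw [map_zero, op_zero])
      map_add' := fun r s => Subtype.ext (by change op (φ (r + s)) = op (φ r) + op (φ s); rw [map_add, op_add]) }
  have ha₀ : ∀ r, ((a₀ r : ↥(Algebra.adjoin (AlgebraicClosure ℚ_[ℓ]) S)) :
      Module.End (AlgebraicClosure ℚ_[ℓ]) (AlgebraicClosure ℚ_[ℓ] ⊗[ℚ_[ℓ]] C.etaleH1 ℓ K)) = op (φ r) := fun _ => rfl
  have hmul₀ : ∀ r s, a₀ (r * s) = a₀ s * a₀ r := fun r s => Subtype.ext (by rw [Subalgebra.coe_mul, ha₀, ha₀, ha₀, hφmul, op_mul])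
  have hcen₀ : ∀ (r : R₀) (x : ↥(Algebra.adjoin (AlgebraicClosure ℚ_[ℓ]) S)), x * a₀ r = a₀ r * x := by
    intro r x
    apply Subtype.ext
    rw [Subalgebra.coe_mul, Subalgebra.coe_mul, ha₀]
    obtain ⟨x, hx⟩ := x
    change x * op (φ r) = op (φ r) * x
    induction hx using Algebra.adjoin_induction with
    | mem s hs =>
      rw [hSop] at hs
      obtain ⟨g, rfl⟩ := hs
      rw [← op_mul, ← op_mul, hφc r _ (T.heckeEnd_mem_heckeImage hD K g)]
    | algebraMap c => exact Algebra.commutes c _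
    | add x y _ _ hx hy => rw [add_mul, mul_add, hx, hy]
    | mul x y _ _ hx hy => rw [mul_assoc, hy, ← mul_assoc, hx, mul_assoc]
  have hone₀ : ∀ n ∈ NM, a₀ 1 • n = n := by
    intro n hn
    obtain ⟨w', hw', hwn⟩ := Submodule.mem_map.1 ((hmemNM n).1 hn)
    rw [hj] at hwn
    have h1 := hsel w' hw' n hwn.symm
    apply hjinj
    rw [hj]
    change (C.toTower ℓ K).baseChange (AlgebraicClosure ℚ_[ℓ]) (op (φ 1) n) = _
    rw [hφ1, hop', h1, hwn]
  have hZ₀ : ∀ z : ↥(Algebra.adjoin (AlgebraicClosure ℚ_[ℓ]) S), (∀ x, z * x = x * z) → z * a₀ 1 = z →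
      z ∈ Submodule.span (AlgebraicClosure ℚ_[ℓ]) (Set.range a₀) := fun z hz hze =>
    T.mem_span_of_forall_comm_of_mul_eq_of_isSemisimpleRing K hD hHK S hS hεH φ hφH hφsurj (a₀ 1) (by rw [ha₀, hφ1, hop']) a₀
      (fun r => by rw [ha₀, hop']) z hz hze
  -- the character of `N_M` and its identification with `τ₀`
  obtain ⟨τ₀', hτ₀'⟩ := Literature.RingTheory.SimpleModule.exists_ringHom_forall_smul_eq (L := AlgebraicClosure ℚ_[ℓ]) NM a₀ hmul₀ hcen₀ hone₀
  obtain ⟨n₀, hn₀N, hn₀⟩ : ∃ n₀ ∈ N₀, n₀ ≠ 0 := by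
    by_contra h
    push Not at h
    exact hN0 ((Submodule.eq_bot_iff _).2 h)
  have hiWn₀ : iW n₀ ∈ NM := by rw [hmemNM, hj]; exact (hN₀ n₀).1 hn₀N
  have hτeq : ∀ r, τ₀' r = τ₀ r := by
    intro r
    have h1 : a₀ r • iW n₀ = τ₀' r • iW n₀ := hτ₀' r _ hiWn₀
    have h2 : a₀ r • iW n₀ = τ₀ r • iW n₀ := by
      change op (φ r) (iW n₀) = _
      rw [hop', show (((rationalTateAction (C.A K) ℓ (φ r)).dualMap).baseChange (AlgebraicClosure ℚ_[ℓ])) (iW n₀) =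
        iW (act' ⟨φ r, hφH r⟩ n₀) from (hact ⟨φ r, hφH r⟩ n₀).symm, hτ₀ r n₀ hn₀N, map_smul]
    have hne : iW n₀ ≠ 0 := fun h0 => hn₀ (hiW (by rw [h0, map_zero]))
    exact smul_left_injective (AlgebraicClosure ℚ_[ℓ]) hne (h1.symm.trans h2)
  -- `iW w` is a `τ₀`-eigenvector, hence `N_M`-isotypic, hence in `N_M`
  have hwM : ∀ r : R₀, a₀ r • iW w = τ₀' r • iW w := fun r => by
    change op (φ r) (iW w) = _
    rw [hop', show (((rationalTateAction (C.A K) ℓ (φ r)).dualMap).baseChange (AlgebraicClosure ℚ_[ℓ])) (iW w) =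
      iW (act' ⟨φ r, hφH r⟩ w) from (hact ⟨φ r, hφH r⟩ w).symm, hw r, map_smul, hτeq]
  have hiso := Literature.RingTheory.SimpleModule.mem_isotypicComponent_of_forall_smul_eq_smul NM a₀ hmul₀ hcen₀ hone₀
    (fun r => τ₀' r) hτ₀' hZ₀ hwM
  letI : AddCommGroup ↥NM := @Submodule.addCommGroup _ _ (Subalgebra.toRing _) inferInstance _ NM
  letI : Module ↥(Algebra.adjoin (AlgebraicClosure ℚ_[ℓ]) S) ↥NM := NM.module
  -- ★ (IX) in its LEVELWISE form: the `N_M`-isotypic component consists of classes under `f(ω^K)` (multiplicity one `hm1`)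
  have hσ' : ∀ g : C.G, σ g = (T.etHeckeRep ℓ g).baseChange (AlgebraicClosure ℚ_[ℓ]) := fun g => by rw [hσ, hX]
  have hjK : LinearMap.range j = σ.fixedPoints (K.1.1 : Subgroup C.G) := by
    rw [hj]; exact T.range_toTower_baseChange_eq_fixedPoints ℓ K hI σ hσ' hD
  have hker : LinearMap.ker f = ⊥ := by
    obtain ⟨w', -, hw'⟩ := hf0
    exact ker_eq_bot_of_mem_omegaHom X ι ρW hf ⟨w', hw'⟩
  have hspan : Submodule.span (AlgebraicClosure ℚ_[ℓ]) {y | ∃ f₁ ∈ X.omegaHom ι ρW, ∃ w' : W, f₁ w' = y} ≤ LinearMap.range f := by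
    refine Submodule.span_le.2 ?_
    rintro _ ⟨f₁, hf₁, w', rfl⟩
    obtain ⟨a, rfl⟩ := hm1 f₁ hf₁
    refine ⟨ι.symm a • w', ?_⟩
    rw [LinearMap.map_smulₛₗ, LinearMap.smul_apply]
    congr 1
    exact ι.apply_symm_apply a
  have hjy := T.map_isotypicComponent_le_span_blockValues_of_levelwise K hI X hX ι ρW hf σ hσ hD hssM
    (Algebra.adjoin (AlgebraicClosure ℚ_[ℓ]) S) h𝒜gen NM hNM ↥NM (LinearEquiv.refl _ _) ⟨iW w, hiso, rfl⟩
  have hrange : j (iW w) ∈ LinearMap.range f := by rw [hj]; exact hspan hjy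
  have hfix : ∀ k ∈ (K.1.1 : Subgroup C.G), (X.rhoEt k).baseChange (AlgebraicClosure ℚ_[ℓ]) (j (iW w)) = j (iW w) := by
    intro k hk
    have : j (iW w) ∈ σ.fixedPoints (K.1.1 : Subgroup C.G) := by rw [← hjK]; exact ⟨iW w, rfl⟩
    rw [Representation.mem_fixedPoints] at this
    rw [← hσ]
    exact this k hk
  have hmem := mem_map_fixedPoints_of_mem_range K X ι ρW hf hker hrange hfix
  rw [hN₀, ← hj]
  exact hmem

end MultOne

end Characters

end Sec42Data.HeckeTranslates

end Literature.NumberTheory.Automorphic.Liu2021.AppendixC
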